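import Summits.HubbardSuperconductivity.HubbardSuperconductivity.Theorems.AnisotropyChordTransferFibre3FinXB2Disc

/-!
# Route `AnisotropyChord` / H0 rotor rung: FIN mid-`L` evaluator XB2 — the objects and the cell certificate are sound

Soundness layer 2b of `…Fibre3FinXB2Eval` (XB2 analogue of g5's `…FinXBCert`): the cell hypotheses `CellHyp2` (g5's `CellHyp` +
nonnegative lower point table), the five object enclosures from the tables (`mem_objB/P/A/Q/C`; `Q` and `B_C` with the
four directions folded onto two), and ★★ `xb2_cell_sound`: `xbCellOK2 L la lb c (tWedgePt L la) (tWedgePt L lb) = true` ⇒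
`c·U ≤ N₁` for every ground two-magnon profile with `λ₂·D ∈ [la, lb]` (same final assembly as `xb_cell_sound`: p1's
`n1_ge_pieces`, `Tplus_bracket`).
Prover seat `hubbard-h0-rotor-p3` g6; helper for piece A = stmt-HubbardSuperconductivity-23918 of rung 19089 (`--supports`, helper
class).  WHAT THIS IS NOT: nothing here proves superconductivity in the Hubbard model (rotor TARGET as worded stays FALSE, g15 verdict);
soundness lemmas for the FIN certificates of ONE conditional reduction.  Tree imports only; no sorry, no new axioms.
-/

set_option linter.dupNamespace false
set_option autoImplicit false

namespace Summit.HubbardSuperconductivity.HubbardSuperconductivity.Theorems.AnisotropyChord.Transfer.Fibre3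

namespace FinXB

open scoped BigOperators
open Finset Hole2 FinCell

variable {L : ℕ} [NeZero L]

/-! ## The cell hypotheses and the objects -/

/-- common hypotheses of the XB2 cell lemmas: g5's `CellHyp` plus the nonnegative lower point table at `la`. -/
structure CellHyp2 (Δ lam2 : ℝ) (f : Tor L → ℝ) (la lb : ℤ) : Prop extends CellHyp (L := L) Δ lam2 f la lb where
  /-- nonnegative lower point table at `la` -/
  hna : gPtNonneg L la = true

namespace CellHyp2

variable {Δ lam2 : ℝ} {f : Tor L → ℝ} {la lb : ℤ} (H : CellHyp2 (L := L) Δ lam2 f la lb)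
include H

/-- the XB2 cell table encloses `T`. [folklore] -/
theorem htt : TTabOK L lam2 (tTab2 L (tWedgePt L la) (tWedgePt L lb)) :=
  fun _ _ hk1 hk2 => mem_tTab2 L H.toCellHyp.hL3 H.hla H.hlb H.toCellHyp.hpos H.hna hk1 hk2
/-- abbreviation: the cell table. -/
def gt (_ : CellHyp2 (L := L) Δ lam2 f la lb) : List (List Iv) := gresCellTab L (cosTab L) la lb
/-- abbreviation: the `T`-table. -/
def tt (_ : CellHyp2 (L := L) Δ lam2 f la lb) : List (List Iv) := tTab2 L (tWedgePt L la) (tWedgePt L lb)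
/-- abbreviation: the scalars. -/
def S (_ : CellHyp2 (L := L) Δ lam2 f la lb) : XBScal := xbScal L la lb (gresCellTab L (cosTab L) la lb)
/-- abbreviation: the per-momentum table. -/
def mt (H : CellHyp2 (L := L) Δ lam2 f la lb) : List (List (Iv × Iv)) := momTab L H.S H.gt H.tt
/-- abbreviation: the direction table `j`. -/
def dt (H : CellHyp2 (L := L) Δ lam2 f la lb) (j : ℕ) : List (List (Iv × Iv × Iv × Iv × Iv)) :=
  dscTab L H.S H.mt (cosTab L) (cosTab (4 * L)) j

/-- `F₂(k)` from the per-momentum table. [folklore] -/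
theorem memF {k1 k2 : ℕ} (hk1 : k1 < L) (hk2 : k2 < L) :
    mem (F2 L f ((((k1 : ℕ) : ZMod L), ((k2 : ℕ) : ZMod L)))) (getT H.mt k1 k2).1 := by
  unfold mt
  rw [getT_momTab _ _ _ hk1 hk2, momAt_fst]
  exact mem_fAt' H.hL H.hΔ0 H.hf H.hla H.hlb H.toCellHyp.hpos H.toCellHyp.hS H.toCellHyp.hlam H.htt hk1 hk2

/-- the disc of `φ̂_e(k)` from the direction table. [folklore] -/
theorem discOK {j : ℕ} (hj : j < 4) {k1 k2 : ℕ} (hk1 : k1 < L) (hk2 : k2 < L) :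
    DiscOK (phiHat L f (eDir L j) ((((k1 : ℕ) : ZMod L), ((k2 : ℕ) : ZMod L))))
      ((getT (H.dt j) k1 k2).1, (getT (H.dt j) k1 k2).2.1, (getT (H.dt j) k1 k2).2.2.1) := by
  unfold dt
  rw [getT_dscTab _ _ _ _ _ hk1 hk2]
  exact dscAt_disc H.hL H.hΔ0 H.hf H.toCellHyp.hlam H.hla H.hlb H.toCellHyp.hpos H.toCellHyp.hS H.htt hj hk1 hk2

/-- `|φ̂_e(k)|²` from the direction table. [folklore] -/
theorem memN2 {j : ℕ} (hj : j < 4) {k1 k2 : ℕ} (hk1 : k1 < L) (hk2 : k2 < L) :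
    mem (Complex.normSq (phiHat L f (eDir L j) ((((k1 : ℕ) : ZMod L), ((k2 : ℕ) : ZMod L)))))
      (getT (H.dt j) k1 k2).2.2.2.2 := by
  have h := mem_n2Of (H.discOK hj hk1 hk2)
  unfold dt at h ⊢
  rw [getT_dscTab _ _ _ _ _ hk1 hk2] at h ⊢
  rw [(dscAt_abs_n2 _ _ _ _ j k1 k2).2]
  exact h

/-- the cross term from the direction table. [folklore] -/
theorem memCross {j : ℕ} (hj : j < 4) {k1 k2 : ℕ} (hk1 : k1 < L) (hk2 : k2 < L) :
    mem (((starRingEnd ℂ) (phiHat L f (eDir L j) ((((k1 : ℕ) : ZMod L), ((k2 : ℕ) : ZMod L)) : Tor L))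
          * phiHat L f (eDir L j) (((((k1 : ℕ) : ZMod L), ((k2 : ℕ) : ZMod L)) : Tor L) + K1 L)).re)
      (crossOfA (getT (H.dt j) k1 k2) (getT (H.dt j) ((k1 + 1) % L) k2)) := by
  have hL0 : 0 < L := by have := H.hL; omega
  have hk1' : (k1 + 1) % L < L := Nat.mod_lt _ hL0
  have h := mem_crossOf (H.discOK hj hk1 hk2) (H.discOK hj hk1' hk2)
  rw [natPair_add_K1]
  rw [crossOfA_eq]
  · exact h
  · unfold dt; rw [getT_dscTab _ _ _ _ _ hk1 hk2]; exact (dscAt_abs_n2 _ _ _ _ j k1 k2).1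
  · unfold dt; rw [getT_dscTab _ _ _ _ _ hk1' hk2]; exact (dscAt_abs_n2 _ _ _ _ j _ k2).1

/-- the XB2 evaluation, unfolded. [folklore] -/
theorem eval_eq : xbEval2 L la lb (tWedgePt L la) (tWedgePt L lb)
    = (H.S, xbObj2 L H.S H.gt H.tt (cosTab L) (cosTab (4 * L))) := rfl

/-- the object record, unfolded. [folklore] -/
theorem obj_eq : xbObj2 L H.S H.gt H.tt (cosTab L) (cosTab (4 * L))
    = { B := idivn (iscale 6 (sumsF L H.mt (cosTab L)).2.2) ((L : ℤ) * L),
        P := idivn (sumsF L H.mt (cosTab L)).1 ((L : ℤ) * L),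
        A := idivn (sumsF L H.mt (cosTab L)).2.1 ((L : ℤ) * L),
        Q := ineg (idivn (iscale 3 (iscale 2 (sumN2F2 L H.mt (H.dt 0) (H.dt 2)))) (2 * ((L : ℤ) * L))),
        C := ineg (idivn (iscale 3 (iscale 2 (sumJ2 L H.mt (H.dt 0) (H.dt 2)))) ((L : ℤ) * L)) } := by
  unfold xbObj2 dt mt
  dsimp only

/-- ★ `B ∈ O.B`. [folklore] -/
theorem mem_objB : mem (Bterm L f) (xbEval2 L la lb (tWedgePt L la) (tWedgePt L lb)).2.B := by
  have hL0 : 0 < L := by have := H.hL; omega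
  rw [H.eval_eq, H.obj_eq]
  show mem (Bterm L f) (idivn (iscale 6 (sumsF L H.mt (cosTab L)).2.2) ((L : ℤ) * L))
  rw [btermOneLoop_holds L f H.toCellHyp.hev, sum_tor_range]
  have hLL : (0 : ℤ) < (L : ℤ) * L := by positivity
  have hs : mem (∑ i ∈ range L, ∑ j ∈ range L,
      F2 L f ((((i : ℕ) : ZMod L), ((j : ℕ) : ZMod L))) ^ 2
        * F2 L f (((((i : ℕ) : ZMod L), ((j : ℕ) : ZMod L)) : Tor L) + K1 L)) (sumsF L H.mt (cosTab L)).2.2 := by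
    unfold sumsF
    refine mem_psum _ _ L fun k1 hk1 => mem_psum _ _ L fun k2 hk2 => ?_
    rw [natPair_add_K1, sq]
    exact mem_imul (mem_imul (H.memF hk1 hk2) (H.memF hk1 hk2)) (H.memF (Nat.mod_lt _ hL0) hk2)
  have h := mem_idivn (mem_iscale 6 hs) hLL
  have e : ∀ x : ℝ, ((6 : ℕ) : ℝ) * x / ((((L : ℤ) * L : ℤ)) : ℝ) = 6 * x / (L : ℝ) ^ 2 := by
    intro x; push_cast; ring
  rw [e] at h
  exact h

/-- ★ `‖Π⁰‖² ∈ O.P`. [folklore] -/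
theorem mem_objP : mem (PiNormSq L f) (xbEval2 L la lb (tWedgePt L la) (tWedgePt L lb)).2.P := by
  have hL0 : 0 < L := by have := H.hL; omega
  rw [H.eval_eq, H.obj_eq]
  show mem (PiNormSq L f) (idivn (sumsF L H.mt (cosTab L)).1 ((L : ℤ) * L))
  rw [piNormOneLoop_holds L f H.toCellHyp.hev, sum_tor_range]
  have hLL : (0 : ℤ) < (L : ℤ) * L := by positivity
  have hs : mem (∑ i ∈ range L, ∑ j ∈ range L, F2 L f ((((i : ℕ) : ZMod L), ((j : ℕ) : ZMod L))) ^ 3)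
      (sumsF L H.mt (cosTab L)).1 := by
    unfold sumsF
    refine mem_psum _ _ L fun k1 hk1 => mem_psum _ _ L fun k2 hk2 => ?_
    have e : F2 L f ((((k1 : ℕ) : ZMod L), ((k2 : ℕ) : ZMod L))) ^ 3
        = F2 L f ((((k1 : ℕ) : ZMod L), ((k2 : ℕ) : ZMod L))) * F2 L f ((((k1 : ℕ) : ZMod L), ((k2 : ℕ) : ZMod L)))
          * F2 L f ((((k1 : ℕ) : ZMod L), ((k2 : ℕ) : ZMod L))) := by ring
    rw [e]
    exact mem_imul (mem_imul (H.memF hk1 hk2) (H.memF hk1 hk2)) (H.memF hk1 hk2)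
  have h := mem_idivn hs hLL
  have e : ∀ x : ℝ, x / ((((L : ℤ) * L : ℤ)) : ℝ) = x / (L : ℝ) ^ 2 := by intro x; push_cast; ring
  rw [e] at h
  exact h

/-- ★ `A(x̂) ∈ O.A`. [folklore] -/
theorem mem_objA : mem (Axhat L f) (xbEval2 L la lb (tWedgePt L la) (tWedgePt L lb)).2.A := by
  have hL0 : 0 < L := by have := H.hL; omega
  rw [H.eval_eq, H.obj_eq]
  show mem (Axhat L f) (idivn (sumsF L H.mt (cosTab L)).2.1 ((L : ℤ) * L))
  rw [axhatOneLoop_holds L f H.toCellHyp.hev, sum_tor_range]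
  have hLL : (0 : ℤ) < (L : ℤ) * L := by positivity
  have hs : mem (∑ i ∈ range L, ∑ j ∈ range L,
      F2 L f ((((i : ℕ) : ZMod L), ((j : ℕ) : ZMod L))) ^ 2
        * Real.cos (2 * Real.pi * ((((i : ℕ) : ZMod L), ((j : ℕ) : ZMod L)) : Tor L).1.val / L))
      (sumsF L H.mt (cosTab L)).2.1 := by
    unfold sumsF
    refine mem_psum _ _ L fun k1 hk1 => mem_psum _ _ L fun k2 hk2 => ?_
    have hv : ((((k1 : ℕ) : ZMod L), ((k2 : ℕ) : ZMod L)) : Tor L).1.val = k1 := by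
      simp only [ZMod.val_natCast, Nat.mod_eq_of_lt hk1]
    rw [hv, sq, Nat.mod_eq_of_lt hk1, getIv_cosTab hk1]
    exact mem_imul (mem_imul (H.memF hk1 hk2) (H.memF hk1 hk2)) (mem_cosIv H.toCellHyp.hL3 hk1)
  have h := mem_idivn hs hLL
  have e : ∀ x : ℝ, x / ((((L : ℤ) * L : ℤ)) : ℝ) = x / (L : ℝ) ^ 2 := by intro x; push_cast; ring
  rw [e] at h
  exact h

/-- ★ `⟨Π⁰, C0⟩ ∈ O.Q` (four directions folded onto two). [folklore] -/
theorem mem_objQ : mem (∑ c : Cfg L, piR L f c * C0fn L Δ lam2 f c) (xbEval2 L la lb (tWedgePt L la) (tWedgePt L lb)).2.Q := by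
  have hL0 : 0 < L := by have := H.hL; omega
  rw [H.eval_eq, H.obj_eq]
  show mem _ (ineg (idivn (iscale 3 (iscale 2 (sumN2F2 L H.mt (H.dt 0) (H.dt 2)))) (2 * ((L : ℤ) * L))))
  rw [piC0OneLoop_holds L Δ lam2 f H.hf.1 H.toCellHyp.hev, nnList_sum_range, ← Finset.sum_div]
  rw [sum_dir4 (fun j => ∑ k : Tor L, Complex.normSq (phiHat L f (eDir L j) k) * F2 L f k)
    (by rw [eDir_one]; exact Finset.sum_congr rfl fun k _ => by rw [normSq_negDir H.toCellHyp.hev])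
    (by rw [eDir_three]; exact Finset.sum_congr rfl fun k _ => by rw [normSq_negDir H.toCellHyp.hev])]
  rw [← Finset.sum_add_distrib, sum_tor_range]
  have hLL : (0 : ℤ) < 2 * ((L : ℤ) * L) := by
    have : (0 : ℤ) < L := by exact_mod_cast hL0
    positivity
  have hs : mem (∑ i ∈ range L, ∑ j' ∈ range L,
      (Complex.normSq (phiHat L f (eDir L 0) ((((i : ℕ) : ZMod L), ((j' : ℕ) : ZMod L))))
          * F2 L f ((((i : ℕ) : ZMod L), ((j' : ℕ) : ZMod L)))
        + Complex.normSq (phiHat L f (eDir L 2) ((((i : ℕ) : ZMod L), ((j' : ℕ) : ZMod L))))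
          * F2 L f ((((i : ℕ) : ZMod L), ((j' : ℕ) : ZMod L)))))
      (sumN2F2 L H.mt (H.dt 0) (H.dt 2)) := by
    unfold sumN2F2
    refine mem_psum _ _ L fun k1 hk1 => mem_psum _ _ L fun k2 hk2 => ?_
    rw [← add_mul]
    exact mem_imul (mem_iadd (H.memN2 (by norm_num) hk1 hk2) (H.memN2 (by norm_num) hk1 hk2)) (H.memF hk1 hk2)
  have h := mem_ineg (mem_idivn (mem_iscale 3 (mem_iscale 2 hs)) hLL)
  have e : ∀ x : ℝ, -(((3 : ℕ) : ℝ) * (((2 : ℕ) : ℝ) * x) / (((2 * ((L : ℤ) * L) : ℤ)) : ℝ)) = -(3 / 2) * (2 * x / (L : ℝ) ^ 2) := by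
    intro x; push_cast; ring
  rw [e] at h
  exact h

/-- ★ `B_C ∈ O.C` (four directions folded onto two). [folklore] -/
theorem mem_objC : mem (BCterm L Δ lam2 f) (xbEval2 L la lb (tWedgePt L la) (tWedgePt L lb)).2.C := by
  have hL0 : 0 < L := by have := H.hL; omega
  rw [H.eval_eq, H.obj_eq]
  show mem _ (ineg (idivn (iscale 3 (iscale 2 (sumJ2 L H.mt (H.dt 0) (H.dt 2)))) ((L : ℤ) * L)))
  rw [bcOneLoop_holds L Δ lam2 f H.hf.1 H.toCellHyp.hev, nnList_sum_range, ← Finset.sum_div]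
  rw [sum_dir4 (fun j => ∑ k : Tor L,
      ((((starRingEnd ℂ) (phiHat L f (eDir L j) k) * phiHat L f (eDir L j) (k + K1 L)).re * (F2 L f k + F2 L f (k + K1 L))
        + Complex.normSq (phiHat L f (eDir L j) k) * F2 L f (k + K1 L))))
    (by rw [eDir_one]; exact Finset.sum_congr rfl fun k _ => by rw [cross_negDir H.toCellHyp.hev, normSq_negDir H.toCellHyp.hev])
    (by rw [eDir_three]; exact Finset.sum_congr rfl fun k _ => by rw [cross_negDir H.toCellHyp.hev, normSq_negDir H.toCellHyp.hev])]
  rw [← Finset.sum_add_distrib, sum_tor_range]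
  have hLL : (0 : ℤ) < (L : ℤ) * L := by positivity
  have hterm : ∀ {j : ℕ} (hj : j < 4) {k1 k2 : ℕ} (hk1 : k1 < L) (hk2 : k2 < L),
      mem (((starRingEnd ℂ) (phiHat L f (eDir L j) ((((k1 : ℕ) : ZMod L), ((k2 : ℕ) : ZMod L)) : Tor L))
              * phiHat L f (eDir L j) (((((k1 : ℕ) : ZMod L), ((k2 : ℕ) : ZMod L)) : Tor L) + K1 L)).re
            * (F2 L f ((((k1 : ℕ) : ZMod L), ((k2 : ℕ) : ZMod L)) : Tor L)
                + F2 L f (((((k1 : ℕ) : ZMod L), ((k2 : ℕ) : ZMod L)) : Tor L) + K1 L))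
          + Complex.normSq (phiHat L f (eDir L j) ((((k1 : ℕ) : ZMod L), ((k2 : ℕ) : ZMod L)) : Tor L))
            * F2 L f (((((k1 : ℕ) : ZMod L), ((k2 : ℕ) : ZMod L)) : Tor L) + K1 L))
        (jTerm L H.mt (H.dt j) k1 k2) := by
    intro j hj k1 k2 hk1 hk2
    have hk1' : (k1 + 1) % L < L := Nat.mod_lt _ hL0
    unfold jTerm
    have hc := H.memCross hj hk1 hk2
    rw [natPair_add_K1] at hc ⊢
    exact mem_iadd (mem_imul hc (mem_iadd (H.memF hk1 hk2) (H.memF hk1' hk2)))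
      (mem_imul (H.memN2 hj hk1 hk2) (H.memF hk1' hk2))
  have hs : mem (∑ i ∈ range L, ∑ j' ∈ range L,
      ((((starRingEnd ℂ) (phiHat L f (eDir L 0) ((((i : ℕ) : ZMod L), ((j' : ℕ) : ZMod L)) : Tor L))
              * phiHat L f (eDir L 0) (((((i : ℕ) : ZMod L), ((j' : ℕ) : ZMod L)) : Tor L) + K1 L)).re
            * (F2 L f ((((i : ℕ) : ZMod L), ((j' : ℕ) : ZMod L)) : Tor L)
                + F2 L f (((((i : ℕ) : ZMod L), ((j' : ℕ) : ZMod L)) : Tor L) + K1 L))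
          + Complex.normSq (phiHat L f (eDir L 0) ((((i : ℕ) : ZMod L), ((j' : ℕ) : ZMod L)) : Tor L))
            * F2 L f (((((i : ℕ) : ZMod L), ((j' : ℕ) : ZMod L)) : Tor L) + K1 L))
        + (((starRingEnd ℂ) (phiHat L f (eDir L 2) ((((i : ℕ) : ZMod L), ((j' : ℕ) : ZMod L)) : Tor L))
              * phiHat L f (eDir L 2) (((((i : ℕ) : ZMod L), ((j' : ℕ) : ZMod L)) : Tor L) + K1 L)).re
            * (F2 L f ((((i : ℕ) : ZMod L), ((j' : ℕ) : ZMod L)) : Tor L)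
                + F2 L f (((((i : ℕ) : ZMod L), ((j' : ℕ) : ZMod L)) : Tor L) + K1 L))
          + Complex.normSq (phiHat L f (eDir L 2) ((((i : ℕ) : ZMod L), ((j' : ℕ) : ZMod L)) : Tor L))
            * F2 L f (((((i : ℕ) : ZMod L), ((j' : ℕ) : ZMod L)) : Tor L) + K1 L))))
      (sumJ2 L H.mt (H.dt 0) (H.dt 2)) := by
    unfold sumJ2
    refine mem_psum _ _ L fun k1 hk1 => mem_psum _ _ L fun k2 hk2 => ?_
    exact mem_iadd (hterm (by norm_num) hk1 hk2) (hterm (by norm_num) hk1 hk2)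
  have h := mem_ineg (mem_idivn (mem_iscale 3 (mem_iscale 2 hs)) hLL)
  have e : ∀ x : ℝ, -(((3 : ℕ) : ℝ) * (((2 : ℕ) : ℝ) * x) / ((((L : ℤ) * L : ℤ)) : ℝ)) = -3 * (2 * x / (L : ℝ) ^ 2) := by
    intro x; push_cast; ring
  rw [e] at h
  exact h

end CellHyp2

/-! ## The cell certificate is sound -/

/-- ★★ THE XB2 CELL CERTIFICATE IS SOUND for the row-`N₁` crux: `cmin · U ≤ N₁` for every ground profile of the cell. [folklore] -/
theorem xb2_cell_sound (hL : 5 ≤ L) {Δ lam2 : ℝ} (hΔ0 : 0 ≤ Δ) (hΔ1 : Δ < 1) {f : Tor L → ℝ}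
    (hf : IsGroundTwoMagnon L Δ lam2 f) {la lb : ℤ}
    (hla : (la : ℝ) ≤ lam2 * ((D : ℤ) : ℝ)) (hlb : lam2 * ((D : ℤ) : ℝ) ≤ (lb : ℝ))
    {cmin : ℚ} (hcert : xbCellOK2 L la lb cmin (tWedgePt L la) (tWedgePt L lb) = true) :
    (cmin : ℝ) * Uunit L Δ f ≤ trialGapN1 L Δ f := by
  -- unpack the certificate
  simp only [xbCellOK2, Bool.and_eq_true, decide_eq_true_eq] at hcert
  obtain ⟨⟨⟨⟨⟨hchk, hsc⟩, hna⟩, hP⟩, hc0⟩, hineq⟩ := hcert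
  have H : CellHyp2 (L := L) Δ lam2 f la lb := ⟨⟨hL, hΔ0, hΔ1, hf, hla, hlb, hchk, hsc⟩, hna⟩
  have hD := D_pos
  set S := (xbEval2 L la lb (tWedgePt L la) (tWedgePt L lb)).1 with hSdef
  set O := (xbEval2 L la lb (tWedgePt L la) (tWedgePt L lb)).2 with hOdef
  have hS : ScalOK L Δ lam2 f S := H.toCellHyp.hS
  have mB := H.mem_objB; have mP := H.mem_objP; have mA := H.mem_objA; have mQ := H.mem_objQ; have mC := H.mem_objC
  rw [← hOdef] at mB mP mA mQ mC
  obtain ⟨mlam, -, ma, -, mfnn, -, -, -, -, -, meps⟩ := hS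
  -- the real bracket ends
  set Blo : ℝ := (O.B.1 : ℝ) / ((D : ℤ) : ℝ)
  set Bhi : ℝ := (O.B.2 : ℝ) / ((D : ℤ) : ℝ)
  set Plo : ℝ := (O.P.1 : ℝ) / ((D : ℤ) : ℝ)
  set Phi : ℝ := (O.P.2 : ℝ) / ((D : ℤ) : ℝ)
  set Ahi : ℝ := (O.A.2 : ℝ) / ((D : ℤ) : ℝ)
  set Qlo : ℝ := (O.Q.1 : ℝ) / ((D : ℤ) : ℝ)
  set Qhi : ℝ := (O.Q.2 : ℝ) / ((D : ℤ) : ℝ)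
  set Clo : ℝ := (O.C.1 : ℝ) / ((D : ℤ) : ℝ)
  have hB1 : Blo ≤ Bterm L f := by rw [div_le_iff₀ hD]; exact mB.1
  have hB2 : Bterm L f ≤ Bhi := by rw [le_div_iff₀ hD]; exact mB.2
  have hP1 : Plo ≤ PiNormSq L f := by rw [div_le_iff₀ hD]; exact mP.1
  have hP2 : PiNormSq L f ≤ Phi := by rw [le_div_iff₀ hD]; exact mP.2
  have hA : Axhat L f ≤ Ahi := by rw [le_div_iff₀ hD]; exact mA.2
  have hQ1 : Qlo ≤ ∑ c : Cfg L, piR L f c * C0fn L Δ lam2 f c := by rw [div_le_iff₀ hD]; exact mQ.1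
  have hQ2 : ∑ c : Cfg L, piR L f c * C0fn L Δ lam2 f c ≤ Qhi := by rw [le_div_iff₀ hD]; exact mQ.2
  have hC : Clo ≤ BCterm L Δ lam2 f := by rw [div_le_iff₀ hD]; exact mC.1
  have hPlo : 0 < Plo := by
    have : (0 : ℝ) < (O.P.1 : ℝ) := by exact_mod_cast hP
    positivity
  have hP2pos : 0 < O.P.2 := by
    have : (O.P.1 : ℝ) ≤ (O.P.2 : ℝ) := mP.1.trans mP.2
    have : O.P.1 ≤ O.P.2 := by exact_mod_cast this
    omega
  -- p1's lower bound
  have hN1 := KT1Assembly.n1_ge_pieces L H.toCellHyp.hL3 hΔ0 hf H.toCellHyp.hlam hB1 hB2 hPlo hP1 hP2 hA hQ1 hQ2 hC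
  -- `n1Lo/D ≤` that expression
  have hLo : ((n1Lo S O : ℤ) : ℝ) ≤
      (-(eps1 L) * Bhi
        + min (min (min (-(Qlo * Blo / Plo)) (-(Qlo * Blo / Phi))) (min (-(Qlo * Bhi / Plo)) (-(Qlo * Bhi / Phi))))
              (min (min (-(Qhi * Blo / Plo)) (-(Qhi * Blo / Phi))) (min (-(Qhi * Bhi / Plo)) (-(Qhi * Bhi / Phi))))
        - eps1 L / 2 * (3 * lam2 * Phi + Qhi + 12 * Δ * f (K1 L) ^ 2 * Ahi) + Clo) * ((D : ℤ) : ℝ) := by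
    have t1 := (mem_imul (mem_ineg meps) (mem_ipt O.B.2)).1
    have c1 := corner_le (q := O.Q.1) (b := O.B.1) hP
    have c2 := corner_le (q := O.Q.1) (b := O.B.1) hP2pos
    have c3 := corner_le (q := O.Q.1) (b := O.B.2) hP
    have c4 := corner_le (q := O.Q.1) (b := O.B.2) hP2pos
    have c5 := corner_le (q := O.Q.2) (b := O.B.1) hP
    have c6 := corner_le (q := O.Q.2) (b := O.B.1) hP2pos
    have c7 := corner_le (q := O.Q.2) (b := O.B.2) hP
    have c8 := corner_le (q := O.Q.2) (b := O.B.2) hP2pos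
    have tmin : ((minCorner O : ℤ) : ℝ) ≤
        min (min (min (-(Qlo * Blo / Plo)) (-(Qlo * Blo / Phi))) (min (-(Qlo * Bhi / Plo)) (-(Qlo * Bhi / Phi))))
            (min (min (-(Qhi * Blo / Plo)) (-(Qhi * Blo / Phi))) (min (-(Qhi * Bhi / Plo)) (-(Qhi * Bhi / Phi))))
          * ((D : ℤ) : ℝ) := by
      unfold minCorner
      push_cast
      simp only [min_mul_of_nonneg _ _ hD.le]
      exact min_le_min (min_le_min (min_le_min c1 c2) (min_le_min c3 c4)) (min_le_min (min_le_min c5 c6) (min_le_min c7 c8))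
    have hX := mem_iadd (mem_iadd (mem_iscale 3 (mem_imul mlam (mem_ipt O.P.2))) (mem_ipt O.Q.2))
      (mem_iscale 12 (mem_imul (mem_imul ma mfnn) (mem_ipt O.A.2)))
    have t3 := (mem_ineg (mem_imul (mem_idivn meps (by norm_num : (0:ℤ) < 2)) hX)).1
    have t4 : ((O.C.1 : ℤ) : ℝ) = Clo * ((D : ℤ) : ℝ) := by rw [div_mul_cancel₀ _ (ne_of_gt hD)]
    unfold n1Lo
    push_cast
    push_cast at t1 t3
    have e3 : -(eps1 L / 2 * (3 * (lam2 * Phi) + Qhi + 12 * (Δ * f (K1 L) * f (K1 L) * Ahi)))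
        = -(eps1 L / 2 * (3 * lam2 * Phi + Qhi + 12 * Δ * f (K1 L) ^ 2 * Ahi)) := by ring
    rw [e3] at t3
    nlinarith [t1, tmin, t3, t4]
  -- `T⁺ ≤ tPlusHi/D`
  have hT := (KT1Assembly.Tplus_bracket L hf.1 hPlo hP1 hP2 hQ1 hQ2).2
  have hThi : Tplus L Δ f * ((D : ℤ) : ℝ) ≤ ((tPlusHi S O : ℤ) : ℝ) := by
    have u1 := (mem_iscale 3 mlam).2
    have u2 := (mem_imul (mem_ipt O.Q.2) (mem_iinv (mem_ipt O.P.1) (by exact hP))).2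
    have u3 := (mem_imul (mem_ipt O.Q.2) (mem_iinv (mem_ipt O.P.2) (by exact hP2pos))).2
    unfold tPlusHi
    push_cast
    push_cast at u1 u2 u3
    rw [← div_eq_mul_one_div] at u2 u3
    have hmax : max (Qhi / Plo) (Qhi / Phi) * ((D : ℤ) : ℝ)
        ≤ max (((imul (ipt O.Q.2) (iinv (ipt O.P.1))).2 : ℤ) : ℝ) (((imul (ipt O.Q.2) (iinv (ipt O.P.2))).2 : ℤ) : ℝ) := by
      rw [max_mul_of_nonneg _ _ hD.le]
      exact max_le_max u2 u3
    nlinarith [hmax, u1, hT]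
  -- assemble
  have hV : (0 : ℝ) ≤ 3 * ((L : ℝ) ^ 2) ^ 2 := by positivity
  have hc0R : (0 : ℝ) ≤ (cmin : ℝ) := by exact_mod_cast hc0
  have hineqR : (cmin : ℝ) * (((3 * ((L : ℤ) * L) ^ 2 * tPlusHi S O : ℤ)) : ℝ) ≤ ((n1Lo S O : ℤ) : ℝ) := by
    exact_mod_cast hineq
  have hU : Uunit L Δ f * ((D : ℤ) : ℝ) ≤ (((3 * ((L : ℤ) * L) ^ 2 * tPlusHi S O : ℤ)) : ℝ) := by
    unfold Uunit
    push_cast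
    have : 3 * ((L : ℝ) ^ 2) ^ 2 * Tplus L Δ f * ((D : ℤ) : ℝ) = 3 * ((L : ℝ) ^ 2) ^ 2 * (Tplus L Δ f * ((D : ℤ) : ℝ)) := by
      ring
    rw [this]
    have h2 := mul_le_mul_of_nonneg_left hThi hV
    calc 3 * ((L : ℝ) ^ 2) ^ 2 * (Tplus L Δ f * ((D : ℤ) : ℝ)) ≤ 3 * ((L : ℝ) ^ 2) ^ 2 * ((tPlusHi S O : ℤ) : ℝ) := h2
      _ = 3 * ((L : ℝ) * L) ^ 2 * ((tPlusHi S O : ℤ) : ℝ) := by ring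
  have h1 : (cmin : ℝ) * Uunit L Δ f * ((D : ℤ) : ℝ) ≤ ((n1Lo S O : ℤ) : ℝ) := by
    have := mul_le_mul_of_nonneg_left hU hc0R
    linarith
  have h2 : ((n1Lo S O : ℤ) : ℝ) ≤ trialGapN1 L Δ f * ((D : ℤ) : ℝ) := hLo.trans (mul_le_mul_of_nonneg_right hN1 hD.le)
  exact le_of_mul_le_mul_right (h1.trans h2) hD

end FinXB

end Summit.HubbardSuperconductivity.HubbardSuperconductivity.Theorems.AnisotropyChord.Transfer.Fibre3
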